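import Mathlib
import Summits.HodgeConjecture.FermatCycles.HodgeFermatLemmaNA

/-!
# LEMMA N with (N-λ) and the fibre identities (E) — part 2: LEMMA N and the identities (E) (`HodgeFermat/LemmaN.lean`)

Tree copy (part 2 of 2) of the module `HodgeFermat/LemmaN.lean` of the sibling cell's standalone package
`run/shared/lean/pub/pub-hodgefermat/lean/HodgeFermat/` (503 lines, sha256 `b5c1c16bd86d874d…`), source lines 243–503 (units among the lifts, the fibre sum, LEMMA N (U)/(Z1), the fibre identities (E), kernel instances).
Filed by cell `pub-hfermat`, seat prover-1 gen-0, on the COORDINATOR KEEPER RULING of 2026-08-25 (gem sweep H1: take the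
off-gate kernel theorem `thmFstar` — `HodgeFermat/DecodingFinal.lean:29` — through the gate); this file is one link of the
minimal import closure of `thmFstar`.  The source module's declarations are VERBATIM those of the cell record
`check/DecodingFinal_standalone.lean` (27 bodies, 454 223 B, sha256 dca6f17de93119a6…, hub `lean check` rc 0, 130.1 s; pub-hodgefermat `CERT.md` l.978, GATE HF-G32).
Deviations from the source module, exhaustively: the `import` lines (tree modules `Summits.HodgeConjecture.FermatCycles.
HodgeFermat*` instead of `HodgeFermat.*`); this module docstring; the namespace/`open` preamble (source l.52–57) is repeated at the top because the module is split; no docstrings needed adding. The module docstring is quoted in full in part 1 (`HodgeFermatLemmaNA.lean`).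
Every other line — in particular every declaration's statement and proof — is byte-identical to the source.
HONEST FRAMING: explicit algebraic cycles for specific Hodge classes on Fermat/Delsarte varieties; residual open instances
listed; no claim on general Hodge.  (This file is arithmetic of CM types; it claims nothing about cycles.)
-/

set_option autoImplicit false

namespace HodgeFermat.KRFree.LemmaN

open Finset

/-! ## Units and the non-unit among the lifts -/

/-- exactly one lift is divisible by `p`: existence -/
lemma nonunit_exists (p n t₀ : ℕ) (hp : p.Prime) (hpn : ¬ p ∣ n) : ∃ j₀, j₀ < p ∧ p ∣ t₀ + j₀ * n := by
  have hco : Nat.Coprime n p := Nat.coprime_comm.mp ((Nat.Prime.coprime_iff_not_dvd hp).mpr hpn)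
  obtain ⟨m, hm, hmn⟩ := Nat.exists_mul_mod_eq_of_coprime (p - t₀ % p) hco hp.ne_zero
  refine ⟨m, hm, Nat.dvd_of_mod_eq_zero ?_⟩
  have h1 : (t₀ + m * n) % p = (t₀ % p + (n * m) % p) % p := by rw [Nat.add_mod, mul_comm m n]
  rw [h1, hmn]
  have ht : t₀ % p < p := Nat.mod_lt _ hp.pos
  rcases Nat.eq_zero_or_pos (t₀ % p) with h0 | h0
  · rw [h0, Nat.zero_add, Nat.sub_zero, Nat.mod_self, Nat.zero_mod]
  · rw [Nat.mod_eq_of_lt (by omega : p - t₀ % p < p)]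
    have e : t₀ % p + (p - t₀ % p) = p := by omega
    rw [e, Nat.mod_self]

/-- exactly one lift is divisible by `p`: uniqueness -/
lemma nonunit_unique {p n t₀ j j' : ℕ} (hp : p.Prime) (hpn : ¬ p ∣ n) (hj : j < p) (hj' : j' < p)
    (h1 : p ∣ t₀ + j * n) (h2 : p ∣ t₀ + j' * n) : j = j' := by
  rcases le_total j j' with hle | hle
  · obtain ⟨d, rfl⟩ := Nat.exists_eq_add_of_le hle
    have e : t₀ + (j + d) * n = (t₀ + j * n) + d * n := by ring
    rw [e, Nat.dvd_add_right h1] at h2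
    rcases (Nat.Prime.dvd_mul hp).mp h2 with h | h
    · rcases Nat.eq_zero_or_pos d with hd | hd
      · omega
      · have := Nat.le_of_dvd hd h; omega
    · exact absurd h hpn
  · obtain ⟨d, rfl⟩ := Nat.exists_eq_add_of_le hle
    have e : t₀ + (j' + d) * n = (t₀ + j' * n) + d * n := by ring
    rw [e, Nat.dvd_add_right h2] at h1
    rcases (Nat.Prime.dvd_mul hp).mp h1 with h | h
    · rcases Nat.eq_zero_or_pos d with hd | hd
      · omega
      · have := Nat.le_of_dvd hd h; omega
    · exact absurd h hpn

/-- a lift not divisible by `p` is a unit of `ℤ/pn` (when `t₀` is a unit of `ℤ/n`) -/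
lemma lift_coprime {p n t₀ j : ℕ} (hp : p.Prime) (ht₀ : Nat.Coprime t₀ n) (hj : ¬ p ∣ t₀ + j * n) :
    Nat.Coprime (t₀ + j * n) (p * n) := by
  refine Nat.Coprime.mul_right ?_ ?_
  · exact ((Nat.Prime.coprime_iff_not_dvd hp).mpr hj).symm
  · exact (Nat.coprime_add_mul_right_left t₀ n j).mpr ht₀

/-- a unit does not kill an entry prime to `p` -/
lemma not_dvd_mul {p n t x : ℕ} (ht : Nat.Coprime t (p * n)) (hx : ¬ p ∣ x) : ¬ p * n ∣ t * x :=
  fun h => hx (Nat.dvd_trans ⟨n, rfl⟩ (Nat.Coprime.dvd_of_dvd_mul_left ht.symm h))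

/-! ## The fibre sum computed over the lifts

For `T = (x, y, z)` with `pn ∣ x + y + z`, `p ∤ z`, and the lifts of a unit `t̄₀`: a unit lift contributes
`rsum = N·(2 − [lift ∈ H_T])`, the non-unit lift `t₀ + j₀n = p t'` contributes `p · rsum_n(t') = p · n · c_T̄(p̄⁻¹t̄₀)`. -/

/-- the per-lift bookkeeping: `Σ_j (rsum_j + N·[unit lift j ∈ H_T]) = (p−1)·2N + p·rsum_n(t₁)`,
stated with `m + 1 = p` -/
lemma lifts_total (p n x y z t₀ t₁ : ℕ) (hp : p.Prime) (hpn : ¬ p ∣ n) (hn : 0 < n)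
    (hs : p * n ∣ x + y + z) (hz : ¬ p ∣ z) (ht₀ : Nat.Coprime t₀ n) (ht₁ : p * t₁ ≡ t₀ [MOD n]) :
    ∃ m, m + 1 = p ∧
      (∑ j ∈ range p, rsum (p * n) (x, y, z) (t₀ + j * n)) + p * n * fibreCount p n (x, y, z) t₀
        = m * (2 * (p * n)) + p * rsum n (x, y, z) t₁ := by
  have hN : 0 < p * n := Nat.mul_pos hp.pos hn
  obtain ⟨j₀, hj₀p, hj₀⟩ := nonunit_exists p n t₀ hp hpn
  have hj₀mem : j₀ ∈ range p := Finset.mem_range.mpr hj₀p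
  -- the summand
  set g : ℕ → ℕ := fun j => rsum (p * n) (x, y, z) (t₀ + j * n)
    + p * n * (if Nat.Coprime (t₀ + j * n) (p * n) ∧ InH (p * n) (x, y, z) (t₀ + j * n) then 1 else 0)
    with hg
  -- unit lifts: summand 2N
  have hunit : ∀ j ∈ (range p).erase j₀, g j = 2 * (p * n) := by
    intro j hj
    rw [Finset.mem_erase] at hj
    obtain ⟨hne, hjr⟩ := hj
    have hjp : j < p := Finset.mem_range.mp hjr
    have hpj : ¬ p ∣ t₀ + j * n := fun h => hne (nonunit_unique hp hpn hjp hj₀p h hj₀)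
    have hco := lift_coprime hp ht₀ hpj
    have hcz := not_dvd_mul hco hz
    obtain ⟨hc, hiff⟩ := rsum_cases (x := x) (y := y) hN hs hcz
    simp only [hg]
    by_cases hin : InH (p * n) (x, y, z) (t₀ + j * n)
    · rw [if_pos ⟨hco, hin⟩, hiff.mp hin]; ring
    · rw [if_neg (fun h => hin h.2)]
      rcases hc with h | h
      · exact absurd (hiff.mpr h) hin
      · rw [h]; ring
  -- the non-unit lift
  have hstar : g j₀ = p * rsum n (x, y, z) t₁ := by
    obtain ⟨t', ht'⟩ := hj₀
    have hnc : ¬ Nat.Coprime (t₀ + j₀ * n) (p * n) :=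
      Nat.not_coprime_of_dvd_of_dvd hp.one_lt ⟨t', ht'⟩ ⟨n, rfl⟩
    simp only [hg, hnc, false_and, if_false, Nat.mul_zero, Nat.add_zero]
    rw [ht', rsum_p_mul]
    have hmod : t' ≡ t₁ [MOD n] := by
      have h1 : p * t' ≡ t₀ [MOD n] := by
        show (p * t') % n = t₀ % n
        rw [← ht']; exact Nat.add_mul_mod_self_right _ _ _
      have hco : Nat.Coprime n p := Nat.coprime_comm.mp ((Nat.Prime.coprime_iff_not_dvd hp).mpr hpn)
      exact Nat.ModEq.cancel_left_of_coprime hco (h1.trans ht₁.symm)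
    rw [rsum_congr (x, y, z) hmod]
  -- assemble
  refine ⟨((range p).erase j₀).card, ?_, ?_⟩
  · rw [Finset.card_erase_add_one hj₀mem, Finset.card_range]
  · have hsplit := Finset.sum_erase_add (range p) g hj₀mem
    rw [Finset.sum_congr rfl hunit, Finset.sum_const, smul_eq_mul, hstar] at hsplit
    have hcount : p * n * fibreCount p n (x, y, z) t₀
        = ∑ j ∈ range p, p * n * (if Nat.Coprime (t₀ + j * n) (p * n) ∧ InH (p * n) (x, y, z) (t₀ + j * n)
            then 1 else 0) := by
      unfold fibreCount
      rw [Finset.card_filter, Finset.mul_sum]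
    rw [hcount, ← Finset.sum_add_distrib]
    exact hsplit.symm

/-! ## LEMMA N -/

/-- `p·q = p·q'` with `p` prime ⇒ `q = q'` -/
lemma cancel_p {p a b : ℕ} (hp : p.Prime) (h : p * a = p * b) : a = b :=
  Nat.eq_of_mul_eq_mul_left hp.pos h

/-- **LEMMA N (U)** (DPRIME §1; KR-FREE §1): `N = pn` (`p` prime, `p ∤ n`), `T = (x, y, z)` with `N ∣ x + y + z`
and `p ∤ xyz`, `t̄₀ ∈ (ℤ/n)ˣ`, `t̄₁ = p̄⁻¹ t̄₀` (`p t₁ ≡ t₀ mod n`).  Then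
`N_T(t̄₀) = (p − 1)/2 + c(t̄₁) − c(t̄₀)`, stated as `2n·N_T(t̄₀) + 2n·c(t̄₀) + n = pn + 2n·c(t̄₁)`
with `n·c(t̄) = rsum n T t`. -/
theorem lemmaN_U (p n x y z t₀ t₁ : ℕ) (hp : p.Prime) (hpn : ¬ p ∣ n) (hn : 0 < n)
    (hs : p * n ∣ x + y + z) (hx : ¬ p ∣ x) (hy : ¬ p ∣ y) (hz : ¬ p ∣ z)
    (ht₀ : Nat.Coprime t₀ n) (ht₁ : p * t₁ ≡ t₀ [MOD n]) :
    2 * n * fibreCount p n (x, y, z) t₀ + 2 * rsum n (x, y, z) t₀ + n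
      = p * n + 2 * rsum n (x, y, z) t₁ := by
  obtain ⟨m, hm, htot⟩ := lifts_total p n x y z t₀ t₁ hp hpn hn hs hz ht₀ ht₁
  subst hm
  have lx := lift_sum (m + 1) n t₀ x hp hn hx
  have ly := lift_sum (m + 1) n t₀ y hp hn hy
  have lz := lift_sum (m + 1) n t₀ z hp hn hz
  have hsum : ∑ j ∈ range (m + 1), rsum ((m + 1) * n) (x, y, z) (t₀ + j * n)
      = (∑ j ∈ range (m + 1), (t₀ + j * n) * x % ((m + 1) * n))
        + (∑ j ∈ range (m + 1), (t₀ + j * n) * y % ((m + 1) * n))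
        + (∑ j ∈ range (m + 1), (t₀ + j * n) * z % ((m + 1) * n)) := by
    unfold rsum; simp only [Finset.sum_add_distrib]
  rw [hsum] at htot
  have hr₀ : rsum n (x, y, z) t₀ = t₀ * x % n + t₀ * y % n + t₀ * z % n := rfl
  rw [hr₀]
  set SX := ∑ j ∈ range (m + 1), (t₀ + j * n) * x % ((m + 1) * n)
  set SY := ∑ j ∈ range (m + 1), (t₀ + j * n) * y % ((m + 1) * n)
  set SZ := ∑ j ∈ range (m + 1), (t₀ + j * n) * z % ((m + 1) * n)
  set F := fibreCount (m + 1) n (x, y, z) t₀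
  set R₁ := rsum n (x, y, z) t₁
  apply cancel_p hp
  zify at htot lx ly lz ⊢
  linear_combination 2 * htot - lx - ly - lz

/-- **LEMMA N (Z1) with (N-λ)** (DPRIME §1; KR-FREE §1): `N = pn` (`p` prime, `p ∤ n`), `T = (py, x₂, x₃)` with
`N ∣ py + x₂ + x₃` and `p ∤ x₂x₃`, `t̄₀ ∈ (ℤ/n)ˣ`, `t̄₁ = p̄⁻¹ t̄₀`, `k₁ := ⌊p⟨t̄₀ȳ⟩_n / n⌋`.  Then
`N_T(t̄₀) = p − 1 − k₁ + c(t̄₁) − c(t̄₀)`, stated as `n·N_T(t̄₀) + n·k₁ + n·c(t̄₀) + n = pn + n·c(t̄₁)`. -/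
theorem lemmaN_Z1 (p n y x₂ x₃ t₀ t₁ : ℕ) (hp : p.Prime) (hpn : ¬ p ∣ n) (hn : 0 < n)
    (hs : p * n ∣ p * y + x₂ + x₃) (hx₂ : ¬ p ∣ x₂) (hx₃ : ¬ p ∣ x₃)
    (ht₀ : Nat.Coprime t₀ n) (ht₁ : p * t₁ ≡ t₀ [MOD n]) :
    n * fibreCount p n (p * y, x₂, x₃) t₀ + n * (p * (t₀ * y % n) / n) + rsum n (p * y, x₂, x₃) t₀ + n
      = p * n + rsum n (p * y, x₂, x₃) t₁ := by
  obtain ⟨m, hm, htot⟩ := lifts_total p n (p * y) x₂ x₃ t₀ t₁ hp hpn hn hs hx₃ ht₀ ht₁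
  subst hm
  have l₂ := lift_sum (m + 1) n t₀ x₂ hp hn hx₂
  have l₃ := lift_sum (m + 1) n t₀ x₃ hp hn hx₃
  have l₁ : ∑ j ∈ range (m + 1), (t₀ + j * n) * ((m + 1) * y) % ((m + 1) * n)
      = (m + 1) * ((m + 1) * (t₀ * y % n)) := by
    rw [Finset.sum_congr rfl (fun j _ => first_mod (m + 1) n t₀ y j), Finset.sum_const, Finset.card_range,
      smul_eq_mul]
  have hsum : ∑ j ∈ range (m + 1), rsum ((m + 1) * n) ((m + 1) * y, x₂, x₃) (t₀ + j * n)
      = (∑ j ∈ range (m + 1), (t₀ + j * n) * ((m + 1) * y) % ((m + 1) * n))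
        + (∑ j ∈ range (m + 1), (t₀ + j * n) * x₂ % ((m + 1) * n))
        + (∑ j ∈ range (m + 1), (t₀ + j * n) * x₃ % ((m + 1) * n)) := by
    unfold rsum; simp only [Finset.sum_add_distrib]
  rw [hsum, l₁] at htot
  -- k₁ and the first residue at level n
  have hk := Nat.div_add_mod ((m + 1) * (t₀ * y % n)) n
  have hρ : (m + 1) * (t₀ * y % n) % n = t₀ * ((m + 1) * y) % n := by
    have h := (Nat.mod_modEq (t₀ * y) n).mul_left (m + 1)
    rw [show (m + 1) * (t₀ * y) = t₀ * ((m + 1) * y) by ring] at h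
    exact h
  rw [hρ] at hk
  have hr₀ : rsum n ((m + 1) * y, x₂, x₃) t₀ = t₀ * ((m + 1) * y) % n + t₀ * x₂ % n + t₀ * x₃ % n := rfl
  rw [hr₀]
  set k₁ := (m + 1) * (t₀ * y % n) / n
  set SY := ∑ j ∈ range (m + 1), (t₀ + j * n) * x₂ % ((m + 1) * n)
  set SZ := ∑ j ∈ range (m + 1), (t₀ + j * n) * x₃ % ((m + 1) * n)
  set F := fibreCount (m + 1) n ((m + 1) * y, x₂, x₃) t₀
  set R₁ := rsum n ((m + 1) * y, x₂, x₃) t₁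
  apply cancel_p hp
  apply Nat.eq_of_mul_eq_mul_left (by norm_num : 0 < 2)
  zify at htot l₂ l₃ hk ⊢
  linear_combination 2 * htot - l₂ - l₃ + 2 * ((m : ℤ) + 1) * hk

/-! ## The fibre identities (E) (KR-FREE §1): two triples of the same CM type have the same fibre counts -/

/-- **(E), Z1–Z1.**  `T = (py, x₂, x₃)`, `T' = (py', x₂', x₃')` (the other entries prime to `p`) of the same
CM type at level `pn`; then for every unit `t̄₀` of `ℤ/n` (with `t̄₁ = p̄⁻¹t̄₀`, `n·c_T(t̄) = rsum n T t`,
`k₁ = ⌊p⟨t₀y⟩_n/n⌋`):  `k₁ + c_T(t̄₀) + c_{T'}(t̄₁) = k₁' + c_{T'}(t̄₀) + c_T(t̄₁)`. -/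
theorem fibre_identity_Z1Z1 (p n y x₂ x₃ y' x₂' x₃' t₀ t₁ : ℕ) (hp : p.Prime) (hpn : ¬ p ∣ n)
    (hn : 0 < n) (hs : p * n ∣ p * y + x₂ + x₃) (hx₂ : ¬ p ∣ x₂) (hx₃ : ¬ p ∣ x₃)
    (hs' : p * n ∣ p * y' + x₂' + x₃') (hx₂' : ¬ p ∣ x₂') (hx₃' : ¬ p ∣ x₃')
    (ht₀ : Nat.Coprime t₀ n) (ht₁ : p * t₁ ≡ t₀ [MOD n])
    (hH : SameType (p * n) (p * y, x₂, x₃) (p * y', x₂', x₃')) :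
    n * (p * (t₀ * y % n) / n) + rsum n (p * y, x₂, x₃) t₀ + rsum n (p * y', x₂', x₃') t₁
      = n * (p * (t₀ * y' % n) / n) + rsum n (p * y', x₂', x₃') t₀ + rsum n (p * y, x₂, x₃) t₁ := by
  have h1 := lemmaN_Z1 p n y x₂ x₃ t₀ t₁ hp hpn hn hs hx₂ hx₃ ht₀ ht₁
  have h2 := lemmaN_Z1 p n y' x₂' x₃' t₀ t₁ hp hpn hn hs' hx₂' hx₃' ht₀ ht₁
  rw [fibreCount_congr hH] at h1
  zify at h1 h2 ⊢
  linear_combination h1 - h2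

/-- **(E), Z1–U.**  `T = (py, x₂, x₃)` (`p ∤ x₂x₃`) and `T' = (x', y', z')` (`p ∤ x'y'z'`) of the same CM type
at level `pn`; then for every unit `t̄₀` of `ℤ/n`:
`2k₁ + 2c_T(t̄₀) + 2c_{T'}(t̄₁) + 1 = p + 2c_T(t̄₁) + 2c_{T'}(t̄₀)`. -/
theorem fibre_identity_Z1U (p n y x₂ x₃ x' y' z' t₀ t₁ : ℕ) (hp : p.Prime) (hpn : ¬ p ∣ n)
    (hn : 0 < n) (hs : p * n ∣ p * y + x₂ + x₃) (hx₂ : ¬ p ∣ x₂) (hx₃ : ¬ p ∣ x₃)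
    (hs' : p * n ∣ x' + y' + z') (hx' : ¬ p ∣ x') (hy' : ¬ p ∣ y') (hz' : ¬ p ∣ z')
    (ht₀ : Nat.Coprime t₀ n) (ht₁ : p * t₁ ≡ t₀ [MOD n])
    (hH : SameType (p * n) (p * y, x₂, x₃) (x', y', z')) :
    2 * n * (p * (t₀ * y % n) / n) + 2 * rsum n (p * y, x₂, x₃) t₀ + 2 * rsum n (x', y', z') t₁ + n
      = p * n + 2 * rsum n (p * y, x₂, x₃) t₁ + 2 * rsum n (x', y', z') t₀ := by
  have h1 := lemmaN_Z1 p n y x₂ x₃ t₀ t₁ hp hpn hn hs hx₂ hx₃ ht₀ ht₁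
  have h2 := lemmaN_U p n x' y' z' t₀ t₁ hp hpn hn hs' hx' hy' hz' ht₀ ht₁
  rw [fibreCount_congr hH] at h1
  zify at h1 h2 ⊢
  linear_combination 2 * h1 - h2

/-- **(E), U–U.**  `T = (x, y, z)`, `T' = (x', y', z')` (all entries prime to `p`) of the same CM type at level
`pn`; then for every unit `t̄₀` of `ℤ/n`: `c_T(t̄₀) + c_{T'}(t̄₁) = c_{T'}(t̄₀) + c_T(t̄₁)`. -/
theorem fibre_identity_UU (p n x y z x' y' z' t₀ t₁ : ℕ) (hp : p.Prime) (hpn : ¬ p ∣ n)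
    (hn : 0 < n) (hs : p * n ∣ x + y + z) (hx : ¬ p ∣ x) (hy : ¬ p ∣ y) (hz : ¬ p ∣ z)
    (hs' : p * n ∣ x' + y' + z') (hx' : ¬ p ∣ x') (hy' : ¬ p ∣ y') (hz' : ¬ p ∣ z')
    (ht₀ : Nat.Coprime t₀ n) (ht₁ : p * t₁ ≡ t₀ [MOD n])
    (hH : SameType (p * n) (x, y, z) (x', y', z')) :
    rsum n (x, y, z) t₀ + rsum n (x', y', z') t₁ = rsum n (x', y', z') t₀ + rsum n (x, y, z) t₁ := by
  have h1 := lemmaN_U p n x y z t₀ t₁ hp hpn hn hs hx hy hz ht₀ ht₁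
  have h2 := lemmaN_U p n x' y' z' t₀ t₁ hp hpn hn hs' hx' hy' hz' ht₀ ht₁
  rw [fibreCount_congr hH] at h1
  omega

/-! ## Kernel instances at `p = 7`, `n = 11` (`N = 77`)

`T = (7·3, 10, 46)` (type Z1 at 7), `t₀ = 3`, `t₁ = 2` (`7·2 ≡ 3 mod 11`): the unit lifts of `3̄` are
`3, 25, 36, 47, 58, 69` and only `47 ∈ H_T`, so `N_T(3̄) = 1`; `k₁ = ⌊7·9/11⌋ = 5`, `c(3̄) = c(2̄) = 2`, and
indeed `1 = p − 1 − k₁ + c_* − c = 6 − 5 + 2 − 2`.  `T' = (1, 2, 74)` (type U): `N_{T'}(3̄) = 3 = (7−1)/2 + 1 − 1`. -/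

example : fibreCount 7 11 (7 * 3, 10, 46) 3 = 1 := by decide
example : 7 * (3 * 3 % 11) / 11 = 5 ∧ rsum 11 (7 * 3, 10, 46) 3 = 22 ∧ rsum 11 (7 * 3, 10, 46) 2 = 22 := by
  decide
example : fibreCount 7 11 (1, 2, 74) 3 = 3 ∧ rsum 11 (1, 2, 74) 3 = 11 ∧ rsum 11 (1, 2, 74) 2 = 11 := by
  decide

/-- the hypotheses of LEMMA N (Z1) are satisfiable and the identity reads `11·1 + 11·5 + 22 + 11 = 77 + 22` -/
example : 11 * fibreCount 7 11 (7 * 3, 10, 46) 3 + 11 * (7 * (3 * 3 % 11) / 11)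
    + rsum 11 (7 * 3, 10, 46) 3 + 11 = 7 * 11 + rsum 11 (7 * 3, 10, 46) 2 :=
  lemmaN_Z1 7 11 3 10 46 3 2 (by norm_num) (by decide) (by decide) (by decide) (by decide) (by decide)
    (by decide) (by decide)

/-- the hypotheses of LEMMA N (U) are satisfiable and the identity reads `2·11·3 + 2·11 + 11 = 77 + 2·11` -/
example : 2 * 11 * fibreCount 7 11 (1, 2, 74) 3 + 2 * rsum 11 (1, 2, 74) 3 + 11
    = 7 * 11 + 2 * rsum 11 (1, 2, 74) 2 :=
  lemmaN_U 7 11 1 2 74 3 2 (by norm_num) (by decide) (by decide) (by decide) (by decide) (by decide)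
    (by decide) (by decide) (by decide)

end HodgeFermat.KRFree.LemmaN
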